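import Summits.AtomisticToContinuum.Crystallization.Theorems.OverbindingBudgetAffineCompressedCutReach

/-!
# NODE g79 «CompressedCut», toward the open leaf NS♭₂ — CHAINS EXIST: the bookkeeping induction from a descent oracle (eighth brick; closes step (i) up to the scale hypothesis)

Route `OverbindingBudget` (Crystallization), crux `RobustDefectLimitWindows` (stmt-AtomisticToContinuum-31280), decomp-a2c lens 4, generation 79, ADDENDUM 11.
Step (i) of the g80 plan (memo NODE-g79 §5, critic rows 1420/1421): registered first-shell CHAINS from the deep site `i` to EVERY site of the `r₁·nn_i` core.

* §1 `eq_of_dist_lt_nearestDist` — ARRIVAL: a site closer to `y m` than its own nearest-neighbour distance is `m`; ★ `chains_of_oracle` — the induction,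
  over an abstract DESCENT ORACLE (from every site of the `ρ·nn_i`-ball toward every target at distance `≥ nn_j` some first-shell pattern point registers
  to a site closer by `g·nn_j`) and a SCALE-ALONG-CHAINS hypothesis (`nn ≥ σ·nn_i` at the end of every registered first-shell chain of length `≤ L` from
  `i` — the shape of the tree's `affFramed_scale_chain_record`, Scale rider p853561): every `m` with `dist (y m) (y i) ≤ r₁·nn_i`, `2r₁ ≤ ρ`,
  `r₁ < L·g·σ` is the END of a registered first-shell chain `c 0 = i, …, c ℓ = m`, `ℓ ≤ L`, all of whose sites stay within `dist (y i) (y m)` of `y m`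
  (so inside the `2r₁·nn_i`-ball, where the frames live).  Chains are `ℕ`-indexed (`c : ℕ → Fin N`), the format of the Chain rider (p853655).
* §2 ★ `descent_step_near` — the oracle at the record constants with threshold `nn_m` and gain `nn_m/5` (same mechanism as the Reach rider's
  `descent_step`, which has threshold `2·nn_m` and gain `9/20·nn_m`): covering constant `1/√2` (`exists_firstShell_inner_ge`, Reach rider) + frame
  tolerance `10⁻³` + registration `10⁻⁴`.
* §3 ★★ `chains_exist_record` — (i) at the record constants over a FRAME ASSIGNMENT on the `ρ·nn_i`-ball (patterns `P j ∈ {fcc, hcp}`, frames `A j`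
  within `10⁻³` of isometries `Q j`, registrations `f j` at `10⁻⁴·nn_j`): every site of the `r₁`-core is reached by a registered first-shell chain of
  length `≤ L` whenever `r₁ < L·σ/5`; the only remaining input is the scale constant `σ` along chains (tree: `σ = 237/250` for `L ≤ 16`, Scale rider),
  e.g. `(r₁, L) = (3, 16)`; for `r₁ = 4` use `L = 22` with the Scale rider's chain lemma at length 22 (`λ²² ≥ 0.93`), or the two-phase gain (Reach
  `descent_step`, 9/20 while `d ≥ 2·nn`) — g80's choice (memo §5 TYPED SHAPES (i)).

Deps: tree only (`…CompressedCutReach` ⊇ BondGraph, Op).  No `instance`, no `notation`, no `set_option`, no new axioms, 0 sorry.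
-/

namespace Summit.AtomisticToContinuum.Crystallization.Theorems.OverbindingBudgetAffineCompressedCutChains

open Literature.Geometry.DiscreteGeometry (nearestDist nearestDist_nonneg nearestDist_le_dist fccTwoShellPattern hcpTwoShellPattern)
open Summit.AtomisticToContinuum.Crystallization.Theorems.OverbindingBudgetAffineCompressedCutReach (exists_firstShell_inner_ge seven_norm_le)

variable {N : ℕ}

/-! ## §1  Arrival and the induction from a descent oracle -/

/-- Arrival criterion: a site closer to `y m` than its own nearest-neighbour distance IS `m`. [this file] -/
theorem eq_of_dist_lt_nearestDist {X : Type*} [MetricSpace X] {y : Fin N → X} {k m : Fin N}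
    (h : dist (y k) (y m) < nearestDist y k) : k = m := by
  by_contra hkm
  have := nearestDist_le_dist y (j := k) (k := m) (fun h' => hkm h'.symm)
  linarith

/-- **Chains from a descent oracle** (the bookkeeping induction of chains-exist).  Sites `y`, a base site `i` with `0 < nn_i`, pattern and
registration assignments `P`, `f`; ORACLE: from every site `j` of the `ρ·nn_i`-ball and toward every target `p` at distance `≥ nn_j` some first-shell
pattern point of `j` registers to a site closer to `p` by `g·nn_j`; SCALE along chains: the end of every registered first-shell chain of length `≤ L`
from `i` has `nn ≥ σ·nn_i`.  Then every site `m` with `dist (y m) (y i) ≤ r₁·nn_i`, `2r₁ ≤ ρ`, `r₁ < L·g·σ`, is the END of a registered first-shell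
chain of length `≤ L` from `i`, all of whose sites lie within `dist (y i) (y m)` of `y m`. [this file] -/
theorem chains_of_oracle {E : Type*} [MetricSpace E] [Norm E] {y : Fin N → E} {i : Fin N} {P : Fin N → Finset E} {f : Fin N → E → E}
    {ρ r₁ g σ : ℝ} {L : ℕ} (hs : 0 < nearestDist y i) (hg : 0 ≤ g) (hρ : 2 * r₁ ≤ ρ) (hL : r₁ < L * g * σ)
    (horacle : ∀ j, dist (y j) (y i) ≤ ρ * nearestDist y i → ∀ p : E, nearestDist y j ≤ dist (y j) p →
      ∃ v ∈ P j, ‖v‖ = 1 ∧ (∃ k, y k = f j v) ∧ dist (f j v) p ≤ dist (y j) p - g * nearestDist y j)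
    (hscale : ∀ ℓ ≤ L, ∀ c : ℕ → Fin N, c 0 = i → (∀ t < ℓ, ∃ v ∈ P (c t), ‖v‖ = 1 ∧ y (c (t + 1)) = f (c t) v) →
      σ * nearestDist y i ≤ nearestDist y (c ℓ))
    (m : Fin N) (hm : dist (y m) (y i) ≤ r₁ * nearestDist y i) :
    ∃ ℓ ≤ L, ∃ c : ℕ → Fin N, c 0 = i ∧ c ℓ = m ∧ (∀ t < ℓ, ∃ v ∈ P (c t), ‖v‖ = 1 ∧ y (c (t + 1)) = f (c t) v) ∧
      ∀ t ≤ ℓ, dist (y (c t)) (y m) ≤ dist (y i) (y m) := by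
  set s := nearestDist y i with hs_def
  set d₀ := dist (y i) (y m) with hd₀
  -- the induction
  have ind : ∀ n ≤ L, ∃ ℓ ≤ n, ∃ c : ℕ → Fin N, c 0 = i ∧ (∀ t < ℓ, ∃ v ∈ P (c t), ‖v‖ = 1 ∧ y (c (t + 1)) = f (c t) v) ∧
      (∀ t ≤ ℓ, dist (y (c t)) (y m) ≤ d₀) ∧ (c ℓ = m ∨ dist (y (c ℓ)) (y m) ≤ d₀ - n * (g * σ * s)) := by
    intro n
    induction n with
    | zero =>
      intro _
      refine ⟨0, le_rfl, fun _ => i, rfl, fun t ht => absurd ht (Nat.not_lt_zero t), fun t _ => le_of_eq hd₀.symm, Or.inr ?_⟩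
      simp [hd₀]
    | succ n ih =>
      intro hn
      obtain ⟨ℓ, hℓn, c, hc0, hch, hdist, hend⟩ := ih (Nat.le_of_succ_le hn)
      rcases hend with hend | hend
      · exact ⟨ℓ, hℓn.trans n.le_succ, c, hc0, hch, hdist, Or.inl hend⟩
      · by_cases hjm : c ℓ = m
        · exact ⟨ℓ, hℓn.trans n.le_succ, c, hc0, hch, hdist, Or.inl hjm⟩
        · -- one more step from `j = c ℓ`
          have hjd : nearestDist y (c ℓ) ≤ dist (y (c ℓ)) (y m) := nearestDist_le_dist y (fun h => hjm h.symm)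
          have hball : dist (y (c ℓ)) (y i) ≤ ρ * s := by
            have h1 := hdist ℓ le_rfl
            have h2 : dist (y (c ℓ)) (y i) ≤ dist (y (c ℓ)) (y m) + dist (y m) (y i) := dist_triangle _ _ _
            have h3 : d₀ ≤ r₁ * s := by rw [hd₀, dist_comm]; exact hm
            rw [dist_comm (y m) (y i)] at h2
            nlinarith [hs]
          obtain ⟨v, hv, hv1, ⟨k, hk⟩, hdec⟩ := horacle (c ℓ) hball (y m) hjd
          have hσ : σ * s ≤ nearestDist y (c ℓ) := hscale ℓ (hℓn.trans (Nat.le_of_succ_le hn)) c hc0 hch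
          refine ⟨ℓ + 1, Nat.succ_le_succ hℓn, fun t => if t ≤ ℓ then c t else k, by simp [hc0], ?_, ?_, Or.inr ?_⟩
          · intro t ht
            rcases Nat.lt_succ_iff_lt_or_eq.1 ht with ht | rfl
            · obtain ⟨w, hw, hw1, hyw⟩ := hch t ht
              refine ⟨w, by simpa [ht.le] using hw, hw1, ?_⟩
              have h1 : t + 1 ≤ ℓ := ht
              simp only [ht.le, h1, if_true]
              exact hyw
            · refine ⟨v, by simpa using hv, hv1, ?_⟩
              simp only [le_rfl, if_true, Nat.not_succ_le_self, if_false]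
              rw [hk]
          · intro t ht
            rcases Nat.lt_succ_iff_lt_or_eq.1 (Nat.lt_succ_of_le ht) with ht' | rfl
            · have : t ≤ ℓ := Nat.lt_succ_iff.1 ht'
              simp only [this, if_true]
              exact hdist t this
            · simp only [Nat.not_succ_le_self, if_false]
              rw [hk]
              have := hdist ℓ le_rfl
              nlinarith [hdec, nearestDist_nonneg y (c ℓ)]
          · simp only [Nat.not_succ_le_self, if_false]
            rw [hk]
            push_cast
            nlinarith [hdec, hσ, hend, hs]
  obtain ⟨ℓ, hℓ, c, hc0, hch, hdist, hend⟩ := ind L le_rfl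
  rcases hend with hend | hend
  · exact ⟨ℓ, hℓ, c, hc0, hend, hch, hdist⟩
  · exfalso
    have h3 : d₀ ≤ r₁ * s := by rw [hd₀, dist_comm]; exact hm
    have h4 : r₁ * s < L * (g * σ * s) := by nlinarith [hL, hs]
    have h5 := dist_nonneg (x := y (c ℓ)) (y := y m)
    linarith


/-! ## §2  The descent oracle at the record constants (threshold `nn`, gain `nn/5`) -/

/-- ★ **DESCENT STEP, near version.**  At a framed, registered site `m` and for every target `p` at distance `d ≥ nn_m` some FIRST-SHELL pattern point `v`
registers to a SITE `f v = y k` with `dist (f v) p ≤ d − nn_m/5`. [this file] -/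
theorem descent_step_near {y : Fin N → EuclideanSpace ℝ (Fin 3)} {m : Fin N} {A : EuclideanSpace ℝ (Fin 3) →ₗ[ℝ] EuclideanSpace ℝ (Fin 3)}
    {Q : EuclideanSpace ℝ (Fin 3) →ₗᵢ[ℝ] EuclideanSpace ℝ (Fin 3)} {P : Finset (EuclideanSpace ℝ (Fin 3))}
    {f : EuclideanSpace ℝ (Fin 3) → EuclideanSpace ℝ (Fin 3)} (hP : P = fccTwoShellPattern ∨ P = hcpTwoShellPattern)
    (hA : ∀ v ∈ P, ‖A v - Q v‖ ≤ 1 / 1000)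
    (hf : ∀ v ∈ P, f v ∈ Set.range y ∧ dist (f v) (y m + nearestDist y m • A v) ≤ 1 / 10 ^ 4 * nearestDist y m)
    (p : EuclideanSpace ℝ (Fin 3)) (hd : nearestDist y m ≤ dist (y m) p) :
    ∃ v ∈ P, ‖v‖ = 1 ∧ (∃ k, y k = f v) ∧ dist (f v) p ≤ dist (y m) p - 1 / 5 * nearestDist y m := by
  have hQs : Function.Surjective Q.toLinearMap :=
    LinearMap.injective_iff_surjective.1 (by rw [LinearIsometry.coe_toLinearMap]; exact Q.injective)
  obtain ⟨u, hu⟩ := hQs (p - y m)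
  rw [LinearIsometry.coe_toLinearMap] at hu
  obtain ⟨w, hw, hw1, hcov⟩ := exists_firstShell_inner_ge hP u
  obtain ⟨k, hk⟩ := (hf w hw).1
  refine ⟨w, hw, hw1, ⟨k, hk⟩, ?_⟩
  set s := nearestDist y m with hs_def
  set d := dist (y m) p with hd_def
  have hs : 0 ≤ s := nearestDist_nonneg y m
  have hdn : ‖p - y m‖ = d := by rw [hd_def, dist_comm, dist_eq_norm]
  have hun : ‖u‖ = d := by rw [← hdn, ← hu]; exact (Q.norm_map u).symm
  obtain ⟨ht, h7⟩ := seven_norm_le hcov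
  rw [hun] at h7
  have ht' : inner ℝ (Q w) (p - y m) = inner ℝ w u := by rw [← hu]; exact Q.inner_map_map w u
  have he : ‖A w - Q w‖ ≤ 1 / 1000 := hA w hw
  have hie : -(1 / 1000 * d) ≤ inner ℝ (A w - Q w) (p - y m) := by
    have h1 := abs_real_inner_le_norm (A w - Q w) (p - y m)
    rw [hdn] at h1
    have h2 : ‖A w - Q w‖ * d ≤ 1 / 1000 * d := mul_le_mul_of_nonneg_right he (by rw [hd_def]; exact dist_nonneg)
    have h3 := neg_abs_le (inner ℝ (A w - Q w) (p - y m))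
    linarith
  have hsplit : inner ℝ (A w) (p - y m) = inner ℝ (A w - Q w) (p - y m) + inner ℝ (Q w) (p - y m) := by
    rw [← inner_add_left, sub_add_cancel]
  have hna : ‖A w‖ ≤ 1 + 1 / 1000 := by
    have e : A w = Q w + (A w - Q w) := by abel
    rw [e]
    refine (norm_add_le _ _).trans ?_
    rw [Q.norm_map, hw1]
    linarith
  have hz : ‖(y m + s • A w) - p‖ ^ 2 = s ^ 2 * ‖A w‖ ^ 2 - 2 * s * inner ℝ (A w) (p - y m) + d ^ 2 := by
    have e : (y m + s • A w) - p = s • A w - (p - y m) := by abel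
    rw [e, norm_sub_sq_real, real_inner_smul_left, norm_smul, Real.norm_eq_abs, abs_of_nonneg hs, hdn]
    ring
  have hzle : ‖(y m + s • A w) - p‖ ^ 2 ≤ (d - 2001 / 10 ^ 4 * s) ^ 2 := by
    rw [hz, hsplit, ht']
    have h1 : s ^ 2 * ‖A w‖ ^ 2 ≤ s ^ 2 * (1 + 1 / 1000) ^ 2 :=
      mul_le_mul_of_nonneg_left (pow_le_pow_left₀ (norm_nonneg _) hna 2) (sq_nonneg s)
    have h2 : -(2 * s * inner ℝ (A w - Q w) (p - y m)) ≤ 2 * s * (1 / 1000 * d) := by nlinarith [hie, hs]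
    have h3 : -(2 * s * inner ℝ w u) ≤ -(2 * s * (7 / 10 * d)) := by nlinarith [h7, hs]
    nlinarith [h1, h2, h3, hd, hs]
  have hβ : 0 ≤ d - 2001 / 10 ^ 4 * s := by linarith [hd, hs]
  have hzp : dist (y m + s • A w) p ≤ d - 2001 / 10 ^ 4 * s := by
    rw [dist_eq_norm]
    exact (pow_le_pow_iff_left₀ (norm_nonneg _) hβ two_ne_zero).1 hzle
  have hreg : dist (f w) (y m + s • A w) ≤ 1 / 10 ^ 4 * s := (hf w hw).2
  calc dist (f w) p ≤ dist (f w) (y m + s • A w) + dist (y m + s • A w) p := dist_triangle _ _ _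
    _ ≤ 1 / 10 ^ 4 * s + (d - 2001 / 10 ^ 4 * s) := add_le_add hreg hzp
    _ = d - 1 / 5 * s := by ring

/-! ## §3  Chains exist at the record constants, over a frame assignment -/

/-- ★★ **CHAINS EXIST (record constants).**  Sites `y` with a FRAME ASSIGNMENT on the `ρ·nn_i`-ball of the base site `i` (`0 < nn_i`): two-shell patterns
`P j ∈ {fcc, hcp}`, frames `A j` within `10⁻³` of isometries `Q j` on `P j`, registrations `f j` at tolerance `10⁻⁴·nn_j` into `range y`; and the scale constant
`σ` along registered first-shell chains of length `≤ L` from `i`.  Then every site `m` of the `r₁·nn_i`-core (`2r₁ ≤ ρ`, `r₁ < L·σ/5`) is the end of a registered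
first-shell chain `c 0 = i, c 1, …, c ℓ = m` with `ℓ ≤ L` (each `y (c (t+1)) = f (c t) v_t`, `v_t ∈ P (c t)`, `‖v_t‖ = 1`), all sites within `dist (y i) (y m)`
of `y m`.  = step (i) of the g80 plan up to the scale input (tree `affFramed_scale_chain_record`: `σ = 237/250` for `L ≤ 16`). [this file] -/
theorem chains_exist_record {y : Fin N → EuclideanSpace ℝ (Fin 3)} {i : Fin N}
    {A : Fin N → (EuclideanSpace ℝ (Fin 3) →ₗ[ℝ] EuclideanSpace ℝ (Fin 3))} {Q : Fin N → (EuclideanSpace ℝ (Fin 3) →ₗᵢ[ℝ] EuclideanSpace ℝ (Fin 3))}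
    {P : Fin N → Finset (EuclideanSpace ℝ (Fin 3))} {f : Fin N → EuclideanSpace ℝ (Fin 3) → EuclideanSpace ℝ (Fin 3)}
    {ρ r₁ σ : ℝ} {L : ℕ} (hs : 0 < nearestDist y i) (hρ : 2 * r₁ ≤ ρ) (hL : r₁ < L * (1 / 5) * σ)
    (hP : ∀ j, dist (y j) (y i) ≤ ρ * nearestDist y i → P j = fccTwoShellPattern ∨ P j = hcpTwoShellPattern)
    (hA : ∀ j, dist (y j) (y i) ≤ ρ * nearestDist y i → ∀ v ∈ P j, ‖A j v - Q j v‖ ≤ 1 / 1000)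
    (hf : ∀ j, dist (y j) (y i) ≤ ρ * nearestDist y i →
      ∀ v ∈ P j, f j v ∈ Set.range y ∧ dist (f j v) (y j + nearestDist y j • A j v) ≤ 1 / 10 ^ 4 * nearestDist y j)
    (hscale : ∀ ℓ ≤ L, ∀ c : ℕ → Fin N, c 0 = i → (∀ t < ℓ, ∃ v ∈ P (c t), ‖v‖ = 1 ∧ y (c (t + 1)) = f (c t) v) →
      σ * nearestDist y i ≤ nearestDist y (c ℓ))
    (m : Fin N) (hm : dist (y m) (y i) ≤ r₁ * nearestDist y i) :
    ∃ ℓ ≤ L, ∃ c : ℕ → Fin N, c 0 = i ∧ c ℓ = m ∧ (∀ t < ℓ, ∃ v ∈ P (c t), ‖v‖ = 1 ∧ y (c (t + 1)) = f (c t) v) ∧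
      ∀ t ≤ ℓ, dist (y (c t)) (y m) ≤ dist (y i) (y m) :=
  chains_of_oracle hs (by norm_num) hρ hL (fun j hj p hp => descent_step_near (hP j hj) (hA j hj) (hf j hj) p hp) hscale m hm

end Summit.AtomisticToContinuum.Crystallization.Theorems.OverbindingBudgetAffineCompressedCutChains
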